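import Literature.NumberTheory.LFunctions.BurnolSonineZeros
import Literature.NumberTheory.LFunctions.BurnolZetaSystemsProofs
import Literature.NumberTheory.LFunctions.BurnolEvaluatorProofs
import Literature.NumberTheory.LFunctions.BurnolFourierZetaSonine
import Literature.NumberTheory.ConnesConsani2021.SoninProjection
import Literature.NumberTheory.ConnesConsani2021.SoninSpaceInfiniteDimensional
import Literature.NumberTheory.LFunctions.BurnolSonineMultisetMinimalityProofs
import Literature.Analysis.DeBrangesSpaces.BurnolEvaluatorTransport
import Mathlib.MeasureTheory.Function.JacobianOneDim
import HarnessLib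

/-!
# Burnol 2004, §7: Theorems 7.1, 7.2, 7.3 ASSEMBLED from Lemmas 7.4, 7.5, 7.6 (doors)

LINE 1 — LABEL: RH-FREE (order bookkeeping on the two indices `a₁(𝒵)`, `a₂(𝒵) ∈ [0, +∞]` attached to
an ARBITRARY multiset `𝒵 ⊂ ℂ`; the Riemann zeta function does not occur). FRAMING (cell rh-crit, D-0074):
corpus theorems are RH-FREE literature; nothing here is worded as progress toward RH. bears_on: B-C/B-P
(LADDER-RH COLUMN 6, de Branges framework) as corpus literature. WHAT THIS IS NOT: not a route, not a
criterion, no positivity; which evaluator systems are minimal or complete in which Sonine space `K_a` is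
RH-free functional analysis; nothing here bears on the truth of RH.

Source: J.-F. Burnol, *Two complete and minimal systems associated with the zeros of the Riemann zeta
function*, J. Théor. Nombres Bordeaux **16** (2004) 65–94 = arXiv:math/0203120v7 [Burnol2004b], §7
(TeX of record `dbl/src/Burnol2004JTNB_arXivmath0203120v7.tex`). The three theorems are typed AS PRINTED
in `BurnolSonineZeros.lean` as the named facts `Burnol2004b_thm7_1` ("`a₁(𝒵) = a₂(𝒵)` always holds",
TeX l.1409–1411), `Burnol2004b_thm7_2` (TeX l.1418–1422) and `Burnol2004b_thm7_3` (TeX l.1424–1428), over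
`sonineMinimalIndex` / `sonineCompleteIndex` (the printed thresholds `a₁`, `a₂` as a `sup` / an `inf` in
`ℝ≥0∞`) and the evaluator systems `sonineZSystem a Z`.

## What is PROVED (theorem-only module: no definition, no named fact)

The printed text derives the three theorems from Lemmas 7.4, 7.5, 7.6 by pure bookkeeping:
"At this stage we have completed the proof of Theorem 7.1: Lemma 7.4 implies `a₂(𝒵) ≤ a₁(𝒵)` and
Lemma 7.5 implies `a₁(𝒵) ≤ a₂(𝒵)`" (TeX l.1493–1496); "This [Lemma 7.6], together with Lemma 7.4,
clearly implies Theorem 7.2. It also implies the Theorem 7.3: let us suppose `a(𝒵) < a < ∞`. Let us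
imagine that after removing finitely many evaluators we do not have a complete system. Then this remaining
system, being not complete, has to be minimal from Lemma 7.4. We just proved that in these circumstances
the system in a `K_b` with `b < a` can not be complete, even after including finitely many arbitrary
evaluators. This gives a contradiction for `a(𝒵) < b < a`." (TeX l.1512–1522). Exactly this is formalised,
with the lemmas (named facts `Burnol2004b_lemma7_4/7_5/7_6` of `BurnolSonineZeros.lean`, staffed
separately) entering as HYPOTHESES of free-standing implications ("doors"):

* `Burnol2004b_thm7_1_of : Burnol2004b_lemma7_4 → Burnol2004b_lemma7_5 → Burnol2004b_thm7_1`;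
* `Burnol2004b_thm7_2_of : Burnol2004b_lemma7_4 → Burnol2004b_lemma7_6 → Burnol2004b_thm7_2`;
* `Burnol2004b_thm7_3_of : (evaluators exist) → Burnol2004b_lemma7_4 → Burnol2004b_lemma7_6 →
  Burnol2004b_thm7_3`, where "(evaluators exist)" is the hypothesis
  `∀ a > 0, ∀ w k, IsSonineZ a w k (sonineZ a w k)` (Thm. 2.1 "the evaluations at complex numbers `w` are
  continuous linear forms on `K_a`" + Riesz, TeX l.437–443; needed only because completeness of a system
  IN `K_a`, as typed, includes membership of its vectors in `K_a`).

Bookkeeping made explicit: the `[0,+∞]` arithmetic of the two indices (`ofReal_le_sonineMinimalIndex`,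
`sonineCompleteIndex_le_ofReal`, `exists_isMinimalSystem_of_lt_sonineMinimalIndex`,
`exists_isCompleteSystemIn_of_sonineCompleteIndex_lt`, `not_isCompleteSystemIn_of_lt_sonineCompleteIndex`,
`not_isMinimalSystem_of_sonineMinimalIndex_lt`), the two printed halves of Thm. 7.1
(`sonineCompleteIndex_le_sonineMinimalIndex_of` from Lemma 7.4, `sonineMinimalIndex_le_sonineCompleteIndex_of`
from Lemma 7.5) and the multiset plumbing `ne_zero_add_of_ne_zero` / `countable_support_add` — these, with
the doors for 7.1/7.2, were written independently by the seat cc-t9 g4 of the cell and are absorbed verbatim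
at its offer (HOME/STATUS 2026-08-26T20:36:30Z); in namespace `BurnolSonineIndex`: completeness is
monotone in the set of vectors and minimality passes to sub-families (`isCompleteSystemIn_of_range_subset`,
`isMinimalSystem_comp_of_injective`); omitting an arbitrary finite set `S` of INDICES `(w,k)` is
dominated by omitting every index at the finitely many affected points `w`, which IS the evaluator system
of a multiset `𝒵'` (`𝒵` zeroed there), with `𝒵 = 𝒵' + F`, `F` finitely supported — the shape in which
Lemmas 7.4 and 7.6 apply; and when `𝒵' = 0` the multiset `𝒵` is finite, so that a complete evaluator
system would make `K_b` finite-dimensional, contradicting the tree theorem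
`Literature.NumberTheory.ConnesConsani2021.not_finiteDimensional_soninSpace` ([Burnol2004, §6]:
`K_a` is infinite-dimensional; "the multiset [of] finite cardinality: then the evaluators are … never
complete", TeX l.1402–1404) — recorded as `not_isCompleteSystemIn_sonineK_of_finite_range` and
`sonineCompleteIndex_eq_top_of_finite`.

No definitions, no new named facts (D-0026); the three `_holds` are one-liners over these doors once the
lemma discharges land.

## Part II (appended): the threshold reading of `a₁(𝒵)`, `a₂(𝒵)` — monotonicity in `a`

"From the fact that the Sonine spaces are a decreasing chain, with evaluators in `K_a` projecting
orthogonally to the evaluators in `K_b` for `b ≥ a`, we may associate in `[0,+∞]` two indices `a₁(𝒵)` and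
`a₂(𝒵)` … such that the evaluators are a minimal system for `a < a₁(𝒵)` and not a minimal system for
`a > a₁(𝒵)` … complete for `a > a₂(𝒵)` but not complete for `a < a₂(𝒵)`" (TeX l.1389–1398). PROVED
(namespace `BurnolSonineIndex`): the pairing identity `inner_eq_inner_of_isSonineZ_of_le` (for `a ≤ a'`
and `g ∈ K_{a'}`, `⟪Z^a_{w,k}, g⟫ = ⟪Z^{a'}_{w,k}, g⟫`, both being `conj(2·𝒢_{ḡ}^{(k)}(w))` — the printed
"projecting orthogonally", over `BurnolEvaluators.inner_eq_setIntegral_Ioi` / `mem_sonineK_of_conj`);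
completeness passes UP in `a` (`isCompleteSystemIn_sonineZSystem_of_le`) and minimality passes DOWN in
`a` (`isMinimalSystem_sonineZSystem_of_le`), hence `a₂(𝒵) < a ⇒` complete in `K_a`
(`isCompleteSystemIn_of_sonineCompleteIndex_lt`) and `a < a₁(𝒵) ⇒` minimal in `K_a`
(`isMinimalSystem_of_lt_sonineMinimalIndex`) — all against evaluator EXISTENCE as the hypothesis `hev`
(Thm. 2.1 + Riesz), through generic Hilbert-space criteria proved here: a vector of `S` orthogonal to a
complete system of `S` vanishes (`eq_zero_of_isCompleteSystemIn`), the converse in a closed subspace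
(`isCompleteSystemIn_of_forall_inner_eq_zero`, orthogonal decomposition along the closed span), and dual
vectors of minimal systems (`exists_dual_vector_of_isMinimalSystem`, `not_mem_closure_span_of_dual_vector`).

## Part III (appended): linear independence of the evaluators of `K_a`; finite multisets

"We note that this provides an alternative route to our statement from [Burnol2002CRAS] that finitely
many evaluators are always linearly independent in `K_a`" (TeX l.1461–1464) and "the multiset [of] finite
cardinality: then the evaluators are always minimal and never complete so that `a₁ = +∞`, and `a₂ = +∞`"
(TeX l.1402–1404). PROVED: `BurnolSonineIndex.linearIndependent_of_isSonineZ` — any assignment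
`(w,k) ↦ Z^λ_{w,k}` of evaluators of `K_λ` (`IsSonineZ`) is linearly independent — by TRANSPORT of the
tree theorem `Burnol2001.Burnol2001CRAS_thm2_3_holds` (the evaluators of `H_Λ`) along `H_Λ = I K_{1/Λ}`:
`exists_mem_sonineK_of_memHLambda` (the `H → K` direction), `setIntegral_invT_mul_invT` (`I` preserves
`∫₀^∞ fg`), `IsCompletedMellin.unique`, `isEvaluatorZ_toLp_invT` (`I` carries `Z^λ_{w,k} ∈ K_λ` to
`Z^{1/λ}_{w,k} ∈ H_{1/λ}`, over dbl-t5's `Burnol2001.isCompletedMellin_toLp_invT`); hence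
`linearIndependent_sonineZ`, `linearIndependent_sonineZSystem`, `isMinimalSystem_sonineZSystem_of_finite`,
`sonineMinimalIndex_eq_top_of_finite` and **Theorem 7.1 for finite multisets unconditionally**
(`sonineMinimalIndex_eq_sonineCompleteIndex_of_finite`). Section I: the hypothesis-free forms of
Thm. 7.3's door (`Burnol2004b_thm7_3_of_lemmas : lemma7_4 → lemma7_6 → thm7_3`) and of the monotonicity
theorems, evaluator existence being the tree theorem `SonineMultiset.isSonineZ_sonineZ` (dbl-t12).
The inversion plumbing (`t ↦ 1/t` quasi-measure-preserving, `‖Ik‖ = ‖k‖`) is re-proved privately, as in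
`BurnolHLambdaDensityProofs.lean` / `BurnolEvaluatorTransport.lean`.

## References
* [Burnol2001CRAS] J.-F. Burnol, C. R. Acad. Sci. Paris Sér. I 333 (2001) 201–206 = arXiv:math/0105120,
  Théorème 2.3 (TeX l.475–477), §2 (TeX l.410–418, 437–441, 463–466), §1 (TeX l.297–302).
* [Burnol2004b] J.-F. Burnol, JTNB 16 (2004) 65–94 = arXiv:math/0203120v7, §7: Thms. 7.1–7.3
  (TeX l.1409–1428), Lemmas 7.4–7.6 and the assembly paragraphs (TeX l.1435–1522), the finite-multiset
  remark (TeX l.1402–1404), Thm. 2.1 (TeX l.437–443).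
* [Burnol2004] J.-F. Burnol, *On Fourier and Zeta(s)*, Forum Math. 16 (2004) 789–840, §6 (`K_a` is
  infinite-dimensional; tree file `ConnesConsani2021/SoninSpaceInfiniteDimensional.lean`).
-/

noncomputable section

open MeasureTheory Complex Filter Set
open scoped ENNReal Topology

namespace Literature.NumberTheory.LFunctions

namespace BurnolSonineIndex

/-! ## A. Generic bookkeeping on complete and minimal systems -/

section Generic

variable {ι κ E : Type*} [AddCommGroup E] [Module ℂ E] [TopologicalSpace E]

/-- Completeness in `S` is monotone in the set of vectors: a family of vectors of `S` whose range contains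
the range of a complete family is complete ("is said to be complete if the linear span … is dense").
[cite: Burnol2004b, §3 (arXiv:math/0203120v7 p. 6, TeX l.551–555)] -/
theorem isCompleteSystemIn_of_range_subset {S : Set E} {u : ι → E} {v : κ → E}
    (hu : IsCompleteSystemIn S u) (hv : ∀ j, v j ∈ S) (h : Set.range u ⊆ Set.range v) :
    IsCompleteSystemIn S v :=
  ⟨hv, hu.2.trans (closure_mono (Submodule.span_mono h))⟩

/-- Minimality passes to sub-families (an injective re-indexing of fewer vectors): "no `u_α` is in the
closure of the linear span of the `u_β`'s, `β ≠ α`" persists when some `u_β` are removed.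
[cite: Burnol2004b, §3 (arXiv:math/0203120v7 p. 6, TeX l.551–555)] -/
theorem isMinimalSystem_comp_of_injective {u : ι → E} (hu : IsMinimalSystem u) {φ : κ → ι}
    (hφ : Function.Injective φ) : IsMinimalSystem (u ∘ φ) := by
  intro j hj
  refine hu (φ j) (closure_mono (Submodule.span_mono ?_) hj)
  rintro _ ⟨j', hj', rfl⟩
  exact ⟨φ j', fun h ↦ hj' (hφ h), rfl⟩

end Generic

/-! ## B. A finite system is never complete in a Sonine space (`K_b` is infinite-dimensional) -/

/-- "As another example we take the multiset to have finite cardinality: then the evaluators are …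
never complete" — indeed NO family with finitely many distinct vectors is complete in `K_b`: its span is
finite-dimensional, hence closed, and `K_b = S(b,b)` is infinite-dimensional ([Burnol2004, §6], tree theorem
`ConnesConsani2021.not_finiteDimensional_soninSpace`). [cite: Burnol2004b, §7 (arXiv:math/0203120v7 p. 17, TeX l.1402–1404)] -/
theorem not_isCompleteSystemIn_sonineK_of_finite_range {ι : Type*} {b : ℝ}
    {u : ι → Lp ℂ 2 (volume : Measure ℝ)} (hfin : (Set.range u).Finite) :
    ¬ IsCompleteSystemIn (sonineK b) u := by
  rintro ⟨-, hsub⟩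
  haveI hfd : FiniteDimensional ℂ (Submodule.span ℂ (Set.range u)) :=
    FiniteDimensional.span_of_finite ℂ hfin
  have hcl : IsClosed (Submodule.span ℂ (Set.range u) : Set (Lp ℂ 2 (volume : Measure ℝ))) :=
    Submodule.closed_of_finiteDimensional _
  rw [hcl.closure_eq] at hsub
  have hle : Literature.NumberTheory.ConnesConsani2021.soninSpace b b ≤ Submodule.span ℂ (Set.range u) := by
    intro f hf
    apply hsub
    rw [sonineK_eq_soninSpace]
    exact hf
  exact Literature.NumberTheory.ConnesConsani2021.not_finiteDimensional_soninSpace b b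
    (Submodule.finiteDimensional_of_le hle)

/-- The evaluator system of a FINITE multiset has finitely many vectors.
[cite: Burnol2004b, §7 (arXiv:math/0203120v7 p. 17, TeX l.1382–1389, 1402–1404)] -/
theorem finite_range_sonineZSystem_of_finite {Z : ℂ → ℕ} (hZ : (Function.support Z).Finite) (b : ℝ) :
    (Set.range (sonineZSystem b Z)).Finite := by
  classical
  set W : Finset ℂ := hZ.toFinset with hW
  set N : ℕ := W.sup Z + 1 with hN
  have hsub : Set.range (sonineZSystem b Z) ⊆
      (fun wk : ℂ × ℕ ↦ sonineZ b wk.1 wk.2) '' ((W : Set ℂ) ×ˢ Set.Iio N) := by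
    rintro _ ⟨p, rfl⟩
    have hp : p.1.2 < Z p.1.1 := p.2
    have hw : p.1.1 ∈ W := by
      rw [hW, Set.Finite.mem_toFinset, Function.mem_support]
      omega
    have hle : Z p.1.1 ≤ W.sup Z := Finset.le_sup hw
    exact ⟨p.1, ⟨hw, by show p.1.2 < N; omega⟩, rfl⟩
  exact ((W.finite_toSet.prod (Set.finite_Iio N)).image _).subset hsub

/-- A finite multiset's evaluators are never complete in any `K_b`.
[cite: Burnol2004b, §7 (arXiv:math/0203120v7 p. 17, TeX l.1402–1404)] -/
theorem not_isCompleteSystemIn_sonineZSystem_of_finite {Z : ℂ → ℕ} (hZ : (Function.support Z).Finite)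
    (b : ℝ) : ¬ IsCompleteSystemIn (sonineK b) (sonineZSystem b Z) :=
  not_isCompleteSystemIn_sonineK_of_finite_range (finite_range_sonineZSystem_of_finite hZ b)

/-- "… never complete so … `a₂ = +∞`": for a finite multiset the completeness index is `+∞`.
[cite: Burnol2004b, §7 (arXiv:math/0203120v7 p. 17, TeX l.1402–1404)] -/
theorem sonineCompleteIndex_eq_top_of_finite {Z : ℂ → ℕ} (hZ : (Function.support Z).Finite) :
    sonineCompleteIndex Z = ⊤ := by
  rw [sonineCompleteIndex, sInf_eq_top]
  rintro x ⟨b, -, -, hcomp⟩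
  exact absurd hcomp (not_isCompleteSystemIn_sonineZSystem_of_finite hZ b)

/-! ## C. Omitting finitely many indices versus removing a finite multiset -/

/-- For a finite set `S` of indices of `𝒵` and the multiset `𝒵'` = "`𝒵` with the finitely many points
touched by `S` removed": every index of `𝒵'` is an index of `𝒵` outside `S` (with the same evaluator), so
the evaluator system of `𝒵'` is a sub-family of the `S`-omitted system. Returned as the two consequences
used below: completeness of the `𝒵'`-system forces completeness of the `S`-omitted system (given that the
latter's vectors lie in `K_a`), and minimality of the `S`-omitted system forces minimality of the
`𝒵'`-system. [cite: Burnol2004b, §7, proof of Thm. 7.3 (arXiv:math/0203120v7 p. 19, TeX l.1513–1522)] -/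
theorem omission_dominated {Z : ℂ → ℕ} (S : Finset (MultisetIndex Z)) (W : Finset ℂ)
    (hW : ∀ p ∈ S, p.1.1 ∈ W) (Z' : ℂ → ℕ) (hZ'W : ∀ w ∈ W, Z' w = 0) (hZ'Z : ∀ w ∉ W, Z' w = Z w)
    (a : ℝ) :
    (IsCompleteSystemIn (sonineK a) (sonineZSystem a Z') →
      (∀ p : {p : MultisetIndex Z // p ∉ S}, sonineZSystem a Z p.1 ∈ sonineK a) →
        IsCompleteSystemIn (sonineK a)
          (fun p : {p : MultisetIndex Z // p ∉ S} ↦ sonineZSystem a Z p.1)) ∧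
    (IsMinimalSystem (fun p : {p : MultisetIndex Z // p ∉ S} ↦ sonineZSystem a Z p.1) →
      IsMinimalSystem (sonineZSystem a Z')) := by
  -- every index `q` of `𝒵'` sits over a point outside `W`, and is an index of `𝒵` outside `S`
  have key : ∀ q : MultisetIndex Z', q.1.1 ∉ W ∧ q.1.2 < Z q.1.1 := by
    intro q
    have hq : q.1.2 < Z' q.1.1 := q.2
    by_cases hw : q.1.1 ∈ W
    · rw [hZ'W _ hw] at hq
      exact absurd hq (Nat.not_lt_zero _)
    · exact ⟨hw, by rwa [hZ'Z _ hw] at hq⟩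
  -- the re-indexing map
  let φ : MultisetIndex Z' → {p : MultisetIndex Z // p ∉ S} := fun q ↦
    ⟨⟨q.1, (key q).2⟩, fun hS ↦ (key q).1 (hW _ hS)⟩
  have hφ : Function.Injective φ := by
    intro q q' h
    have h1 : (φ q).1.1 = (φ q').1.1 := by rw [h]
    exact Subtype.ext h1
  have hcomp : (fun p : {p : MultisetIndex Z // p ∉ S} ↦ sonineZSystem a Z p.1) ∘ φ =
      sonineZSystem a Z' := by
    funext q
    rfl
  refine ⟨fun hc hmem ↦ ?_, fun hmin ↦ ?_⟩
  · refine isCompleteSystemIn_of_range_subset hc hmem ?_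
    rintro _ ⟨q, rfl⟩
    exact ⟨φ q, by rw [← hcomp]; rfl⟩
  · rw [← hcomp]
    exact isMinimalSystem_comp_of_injective hmin hφ

end BurnolSonineIndex

open BurnolSonineIndex

/-! ## D. The indices `a₁(𝒵)`, `a₂(𝒵)` in `[0, +∞]` and the doors for Thms. 7.1, 7.2

(The `sSup`/`sInf` bookkeeping lemmas, the two printed halves of Thm. 7.1 and the door for Thm. 7.2 below
were written independently by the seat cc-t9 g4 (banked bytes `HOME/drafts/dbl/cc-t9g4_BurnolSonineIndicesProofs_GREEN-unfiled.lean`,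
2026-08-26T20:36Z) and are absorbed here verbatim at its offer.) -/


/-- Minimality in `K_a` (`a > 0`) puts `a` below `a₁(𝒵)`. [cite: Burnol2004b, §7 (arXiv:math/0203120v7 p. 17, TeX l.1389–1398)] -/
theorem ofReal_le_sonineMinimalIndex {Z : ℂ → ℕ} {a : ℝ} (ha : 0 < a)
    (h : IsMinimalSystem (sonineZSystem a Z)) : ENNReal.ofReal a ≤ sonineMinimalIndex Z :=
  le_sSup ⟨a, ha, rfl, h⟩

/-- Completeness in `K_a` (`a > 0`) puts `a₂(𝒵)` below `a`. [cite: Burnol2004b, §7 (arXiv:math/0203120v7 p. 17, TeX l.1389–1398)] -/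
theorem sonineCompleteIndex_le_ofReal {Z : ℂ → ℕ} {a : ℝ} (ha : 0 < a)
    (h : IsCompleteSystemIn (sonineK a) (sonineZSystem a Z)) : sonineCompleteIndex Z ≤ ENNReal.ofReal a :=
  sInf_le ⟨a, ha, rfl, h⟩

/-- Below `a₁(𝒵)` there is a larger `a` with the system minimal in `K_a` (the `sup`).
[cite: Burnol2004b, §7 (arXiv:math/0203120v7 p. 17, TeX l.1389–1398)] -/
theorem exists_isMinimalSystem_of_lt_sonineMinimalIndex {Z : ℂ → ℕ} {x : ℝ≥0∞}
    (h : x < sonineMinimalIndex Z) :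
    ∃ a : ℝ, 0 < a ∧ x < ENNReal.ofReal a ∧ IsMinimalSystem (sonineZSystem a Z) := by
  obtain ⟨y, ⟨a, ha, rfl, hmin⟩, hxy⟩ := lt_sSup_iff.1 h
  exact ⟨a, ha, hxy, hmin⟩

/-- Above `a₂(𝒵)` there is a smaller `a` with the system complete in `K_a` (the `inf`).
[cite: Burnol2004b, §7 (arXiv:math/0203120v7 p. 17, TeX l.1389–1398)] -/
theorem exists_isCompleteSystemIn_of_sonineCompleteIndex_lt {Z : ℂ → ℕ} {x : ℝ≥0∞}
    (h : sonineCompleteIndex Z < x) :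
    ∃ a : ℝ, 0 < a ∧ ENNReal.ofReal a < x ∧ IsCompleteSystemIn (sonineK a) (sonineZSystem a Z) := by
  obtain ⟨y, ⟨a, ha, rfl, hc⟩, hxy⟩ := sInf_lt_iff.1 h
  exact ⟨a, ha, hxy, hc⟩

/-- For `0 < a < a₂(𝒵)` the system is NOT complete in `K_a`. [cite: Burnol2004b, §7 (arXiv:math/0203120v7 p. 17, TeX l.1389–1398)] -/
theorem not_isCompleteSystemIn_of_lt_sonineCompleteIndex {Z : ℂ → ℕ} {a : ℝ} (ha : 0 < a)
    (h : ENNReal.ofReal a < sonineCompleteIndex Z) :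
    ¬ IsCompleteSystemIn (sonineK a) (sonineZSystem a Z) :=
  fun hc ↦ (not_le.2 h) (sonineCompleteIndex_le_ofReal ha hc)

/-- For `a₁(𝒵) < a` the system is NOT minimal in `K_a`. [cite: Burnol2004b, §7 (arXiv:math/0203120v7 p. 17, TeX l.1389–1398)] -/
theorem not_isMinimalSystem_of_sonineMinimalIndex_lt {Z : ℂ → ℕ} {a : ℝ} (ha : 0 < a)
    (h : sonineMinimalIndex Z < ENNReal.ofReal a) : ¬ IsMinimalSystem (sonineZSystem a Z) :=
  fun hm ↦ (not_le.2 h) (ofReal_le_sonineMinimalIndex ha hm)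

/-! ## Thm. 7.1: `a₂(𝒵) ≤ a₁(𝒵)` from Lemma 7.4, `a₁(𝒵) ≤ a₂(𝒵)` from Lemma 7.5 -/

/-- **`a₂(𝒵) ≤ a₁(𝒵)`** for a non-empty multiset, from Lemma 7.4 («Lemma [7.4] implies
`a₂(𝒵) ≤ a₁(𝒵)`»: below `a₂` the system is not complete, hence minimal).
[cite: Burnol2004b, Thm. 7.1 proof (arXiv:math/0203120v7 p. 18, TeX l.1493–1497); Lemma 7.4 (TeX l.1435–1459)] -/
theorem sonineCompleteIndex_le_sonineMinimalIndex_of (h74 : Burnol2004b_lemma7_4) {Z : ℂ → ℕ}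
    (hZ : Z ≠ 0) (hc : (Function.support Z).Countable) :
    sonineCompleteIndex Z ≤ sonineMinimalIndex Z := by
  refine le_of_forall_lt fun c hc2 ↦ ?_
  -- a real level strictly between `c` and `a₂(𝒵)`
  obtain ⟨d, hcd, hd2⟩ := exists_between hc2
  have hdtop : d ≠ ⊤ := ne_top_of_lt hd2
  have hd0 : d ≠ 0 := by
    rintro rfl
    exact ENNReal.not_lt_zero hcd
  have hdpos : 0 < d.toReal := ENNReal.toReal_pos hd0 hdtop
  have hdeq : ENNReal.ofReal d.toReal = d := ENNReal.ofReal_toReal hdtop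
  have hnc : ¬ IsCompleteSystemIn (sonineK d.toReal) (sonineZSystem d.toReal Z) :=
    not_isCompleteSystemIn_of_lt_sonineCompleteIndex hdpos (by rwa [hdeq])
  have hmin : IsMinimalSystem (sonineZSystem d.toReal Z) := h74 Z hZ hc d.toReal hdpos hnc
  have hle : d ≤ sonineMinimalIndex Z := by
    rw [← hdeq]; exact ofReal_le_sonineMinimalIndex hdpos hmin
  exact lt_of_lt_of_le hcd hle

/-- **`a₁(𝒵) ≤ a₂(𝒵)`** for a non-empty multiset, from Lemma 7.5 («Lemma [7.5] implies
`a₁(𝒵) ≤ a₂(𝒵)`»: a minimal `K_a` above a complete `K_b`, `b < a`, is impossible).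
[cite: Burnol2004b, Thm. 7.1 proof (arXiv:math/0203120v7 p. 18, TeX l.1493–1497); Lemma 7.5 (TeX l.1467–1491)] -/
theorem sonineMinimalIndex_le_sonineCompleteIndex_of (h75 : Burnol2004b_lemma7_5) {Z : ℂ → ℕ}
    (hZ : Z ≠ 0) (hc : (Function.support Z).Countable) :
    sonineMinimalIndex Z ≤ sonineCompleteIndex Z := by
  by_contra h
  have hlt : sonineCompleteIndex Z < sonineMinimalIndex Z := lt_of_not_ge h
  obtain ⟨a, ha, h2a, hmin⟩ := exists_isMinimalSystem_of_lt_sonineMinimalIndex hlt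
  obtain ⟨b, hb, hba, hcomp⟩ := exists_isCompleteSystemIn_of_sonineCompleteIndex_lt h2a
  have hba' : b < a := (ENNReal.ofReal_lt_ofReal_iff ha).1 hba
  exact h75 Z hZ hc a ha hmin b hb hba' hcomp

/-- **Burnol 2004, Theorem 7.1** («The equality `a₁(𝒵) = a₂(𝒵)` always holds») **from Lemmas 7.4
and 7.5**, exactly as printed: «Lemma [7.4] implies `a₂(𝒵) ≤ a₁(𝒵)` and Lemma [7.5] implies
`a₁(𝒵) ≤ a₂(𝒵)`».  RH-FREE; the lemmas enter as hypotheses (named facts of `BurnolSonineZeros.lean`).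
[cite: Burnol2004b, Thm. 7.1 (arXiv:math/0203120v7 p. 17, TeX l.1409–1411; proof TeX l.1493–1497)] -/
theorem Burnol2004b_thm7_1_of (h74 : Burnol2004b_lemma7_4) (h75 : Burnol2004b_lemma7_5) :
    Burnol2004b_thm7_1 :=
  fun _ hZ hc ↦ le_antisymm (sonineMinimalIndex_le_sonineCompleteIndex_of h75 hZ hc)
    (sonineCompleteIndex_le_sonineMinimalIndex_of h74 hZ hc)

/-! ## Thm. 7.2 from Lemmas 7.6 and 7.4 -/

/-- Adding a multiset to a non-empty one keeps it non-empty. [cite: Burnol2004b, Thm. 7.2 (arXiv:math/0203120v7 p. 18, TeX l.1418–1422)] -/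
theorem ne_zero_add_of_ne_zero {Z : ℂ → ℕ} (hZ : Z ≠ 0) (F : ℂ → ℕ) : Z + F ≠ 0 := by
  intro h
  apply hZ
  funext w
  have hw := congrFun h w
  simp only [Pi.add_apply, Pi.zero_apply, Nat.add_eq_zero_iff] at hw
  exact hw.1

/-- The support of a sum of multisets is countable when both supports are.
[cite: Burnol2004b, Thm. 7.2 (arXiv:math/0203120v7 p. 18, TeX l.1418–1422)] -/
theorem countable_support_add {Z F : ℂ → ℕ} (hZ : (Function.support Z).Countable)
    (hF : (Function.support F).Countable) : (Function.support (Z + F)).Countable :=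
  (hZ.union hF).mono (Function.support_add Z F)

/-- **Burnol 2004, Theorem 7.2 from Lemmas 7.4 and 7.6**, exactly as printed («This [Lemma 7.6],
together with Lemma [7.4], clearly implies [Theorem 7.2]»): for `0 < a < a(𝒵) = a₁(𝒵)` and a finite
multiset `F`, the evaluators of `𝒵 + F` are not complete in `K_a` (Lemma 7.6 from a minimal `K_{a′}`,
`a < a′`, given by the `sup`) and minimal there (Lemma 7.4 for the non-empty countable multiset
`𝒵 + F`).  RH-FREE; the lemmas enter as hypotheses (named facts of `BurnolSonineZeros.lean`).
[cite: Burnol2004b, Thm. 7.2 (arXiv:math/0203120v7 p. 18, TeX l.1418–1422; deduction TeX l.1498–1512)] -/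
theorem Burnol2004b_thm7_2_of (h74 : Burnol2004b_lemma7_4) (h76 : Burnol2004b_lemma7_6) :
    Burnol2004b_thm7_2 := by
  intro Z hZ hc a ha haZ F hF
  obtain ⟨a', ha', haa', hmin⟩ := exists_isMinimalSystem_of_lt_sonineMinimalIndex haZ
  have hlt : a < a' := (ENNReal.ofReal_lt_ofReal_iff ha').1 haa'
  have hnc : ¬ IsCompleteSystemIn (sonineK a) (sonineZSystem a (Z + F)) :=
    h76 Z hZ hc a' ha' hmin a ha hlt F hF
  have hZF : Z + F ≠ 0 := ne_zero_add_of_ne_zero hZ F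
  have hcF : (Function.support (Z + F)).Countable := countable_support_add hc hF.countable
  exact ⟨h74 (Z + F) hZF hcF a ha hnc, hnc⟩


/-! ## E. The door for Thm. 7.3 (omitting finitely many evaluators) -/

/-- **Theorem 7.3 from Lemmas 7.4 and 7.6** ("let us suppose `a(𝒵) < a < ∞`. Let us imagine that after
removing finitely many evaluators we do not have a complete system. Then this remaining system, being not
complete, has to be minimal from Lemma 7.4. We just proved that in these circumstances the system in a
`K_b` with `b < a` can not be complete, even after including finitely many arbitrary evaluators. This gives
a contradiction for `a(𝒵) < b < a`"). The hypothesis `a₂(𝒵) < a` supplies `b < a` with the system of `𝒵`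
complete in `K_b`; omitting the finite index set `S` is dominated by removing the finite multiset `F` of
all indices at the points touched by `S` (`𝒵 = 𝒵' + F`, `omission_dominated`), to which Lemmas 7.4/7.6
apply when `𝒵' ≠ 0`; when `𝒵' = 0` the multiset `𝒵` is finite and completeness in `K_b` is absurd
(`K_b` infinite-dimensional). Evaluator existence (Thm. 2.1 + Riesz: "the evaluations at complex numbers
`w ∈ ℂ` are continuous linear forms on `K_a`") enters as the hypothesis `hev`, because completeness IN
`K_a` as typed includes membership of the vectors in `K_a`.
[cite: Burnol2004b, Thm. 7.3 and TeX l.1513–1522, Thm. 2.1 (arXiv:math/0203120v7 pp. 5, 18–19; TeX l.437–443, 1424–1428, 1513–1522)] -/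
theorem Burnol2004b_thm7_3_of
    (hev : ∀ a : ℝ, 0 < a → ∀ (w : ℂ) (k : ℕ), IsSonineZ a w k (sonineZ a w k))
    (h74 : Burnol2004b_lemma7_4) (h76 : Burnol2004b_lemma7_6) :
    Burnol2004b_thm7_3 := by
  classical
  intro Z hZ hcount a ha hlt S
  rw [sonineCompleteIndex] at hlt
  -- `a₂ < a`: a level `b < a` at which the system of `𝒵` is complete
  obtain ⟨x, hx, hxa⟩ := sInf_lt_iff.1 hlt
  obtain ⟨b, hb, rfl, hcomp⟩ := hx
  have hba : b < a := (ENNReal.ofReal_lt_ofReal_iff ha).1 hxa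
  -- the points touched by `S`, the trimmed multiset `𝒵'` and the removed finite multiset `F`
  set W : Finset ℂ := S.image (fun p : MultisetIndex Z ↦ p.1.1) with hWdef
  have hW : ∀ p ∈ S, p.1.1 ∈ W := fun p hp ↦ Finset.mem_image_of_mem (fun p : MultisetIndex Z ↦ p.1.1) hp
  set Z' : ℂ → ℕ := fun w ↦ if w ∈ W then 0 else Z w with hZ'def
  set F : ℂ → ℕ := fun w ↦ if w ∈ W then Z w else 0 with hFdef
  have hZ'W : ∀ w ∈ W, Z' w = 0 := fun w hw ↦ by simp [hZ'def, hw]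
  have hZ'Z : ∀ w ∉ W, Z' w = Z w := fun w hw ↦ by simp [hZ'def, hw]
  have hZF : Z' + F = Z := by
    funext w
    by_cases hw : w ∈ W <;> simp [hZ'def, hFdef, hw]
  have hF : (Function.support F).Finite := by
    refine W.finite_toSet.subset fun w hw ↦ ?_
    rw [Finset.mem_coe]
    by_contra hwW
    exact hw (by simp [hFdef, hwW])
  have hcountZ' : (Function.support Z').Countable := by
    refine hcount.mono fun w hw ↦ ?_
    by_cases hwW : w ∈ W
    · exact absurd (hZ'W w hwW) hw
    · rw [Function.mem_support, ← hZ'Z w hwW]; exact hw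
  -- the finite case `𝒵' = 0`: `𝒵` is finite, completeness in `K_b` is absurd
  have hfin : Z' = 0 → False := by
    intro h0
    have hZfin : (Function.support Z).Finite := by
      refine W.finite_toSet.subset fun w hw ↦ ?_
      rw [Finset.mem_coe]
      by_contra hwW
      have := congrFun h0 w
      rw [hZ'Z w hwW] at this
      exact hw this
    exact not_isCompleteSystemIn_sonineZSystem_of_finite hZfin b hcomp
  -- the dominated omission
  have hdom := omission_dominated S W hW Z' hZ'W hZ'Z a
  -- Lemma 7.6 applied to a minimal `𝒵'`-system contradicts completeness at `b`
  have hcontra : IsMinimalSystem (sonineZSystem a Z') → Z' ≠ 0 → False := by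
    intro hmin hZ'0
    have h := h76 Z' hZ'0 hcountZ' a ha hmin b hb hba F hF
    rw [hZF] at h
    exact h hcomp
  refine ⟨?_, fun hminS ↦ ?_⟩
  · -- complete after omitting `S`
    by_contra hnc
    rcases eq_or_ne Z' 0 with hZ'0 | hZ'0
    · exact hfin hZ'0
    · have hmem : ∀ p : {p : MultisetIndex Z // p ∉ S}, sonineZSystem a Z p.1 ∈ sonineK a :=
        fun p ↦ (hev a ha p.1.1.1 p.1.1.2).1
      have hnc' : ¬ IsCompleteSystemIn (sonineK a) (sonineZSystem a Z') :=
        fun hc ↦ hnc (hdom.1 hc hmem)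
      exact hcontra (h74 Z' hZ'0 hcountZ' a ha hnc') hZ'0
  · -- not minimal after omitting `S`
    rcases eq_or_ne Z' 0 with hZ'0 | hZ'0
    · exact hfin hZ'0
    · exact hcontra (hdom.2 hminS) hZ'0


/-! ## F. Generic Hilbert-space criteria for completeness and minimality (dual vectors) -/

namespace BurnolSonineIndex

section Hilbert

open scoped InnerProductSpace

variable {E : Type*} [NormedAddCommGroup E] [InnerProductSpace ℂ E]

/-- A vector orthogonal to a set is orthogonal to the closed linear span of the set. [folklore] -/
private theorem inner_eq_zero_of_mem_closure_span {S : Set E} {g x : E} (h0 : ∀ s ∈ S, ⟪s, g⟫_ℂ = 0)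
    (hx : x ∈ closure (Submodule.span ℂ S : Set E)) : ⟪x, g⟫_ℂ = 0 := by
  have hle : Submodule.span ℂ S ≤ (ℂ ∙ g)ᗮ :=
    Submodule.span_le.2 fun s hs ↦ (Submodule.mem_orthogonal_singleton_iff_inner_left).2 (h0 s hs)
  have hcl : closure (Submodule.span ℂ S : Set E) ⊆ ((ℂ ∙ g)ᗮ : Set E) :=
    closure_minimal hle (Submodule.isClosed_orthogonal _)
  exact (Submodule.mem_orthogonal_singleton_iff_inner_left).1 (hcl hx)

/-- In a complete system in `S`, a vector of `S` orthogonal to every vector of the system is `0`.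
[cite: Burnol2004b, §3 (arXiv:math/0203120v7 p. 6, TeX l.551–555)] -/
theorem eq_zero_of_isCompleteSystemIn {ι : Type*} {S : Set E} {u : ι → E}
    (h : IsCompleteSystemIn S u) {g : E} (hg : g ∈ S) (h0 : ∀ i, ⟪u i, g⟫_ℂ = 0) : g = 0 := by
  have hg' : g ∈ closure (Submodule.span ℂ (Set.range u) : Set E) := h.2 hg
  have h1 : ⟪g, g⟫_ℂ = 0 :=
    inner_eq_zero_of_mem_closure_span (by rintro _ ⟨i, rfl⟩; exact h0 i) hg'
  exact inner_self_eq_zero.1 h1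

/-- A vector with a dual vector (orthogonal to the others, not to it) is outside the closed span of the
others. [cite: Burnol2004b, §3 (arXiv:math/0203120v7 p. 6, TeX l.551–555)] -/
theorem not_mem_closure_span_of_dual_vector {ι : Type*} {u : ι → E} {i : ι} {g : E}
    (h0 : ∀ j, j ≠ i → ⟪u j, g⟫_ℂ = 0) (h1 : ⟪u i, g⟫_ℂ ≠ 0) :
    u i ∉ closure (Submodule.span ℂ (u '' {j | j ≠ i}) : Set E) := fun hmem ↦
  h1 (inner_eq_zero_of_mem_closure_span (by rintro _ ⟨j, hj, rfl⟩; exact h0 j hj) hmem)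

variable [CompleteSpace E]

/-- **Completeness criterion in a closed subspace `V`**: a family of vectors of `V` such that the only
vector of `V` orthogonal to all of them is `0` is complete in `V` (decompose `g ∈ V` along the closed span
and its orthogonal complement). [cite: Burnol2004b, §3 (arXiv:math/0203120v7 p. 6, TeX l.551–555)] -/
theorem isCompleteSystemIn_of_forall_inner_eq_zero {ι : Type*} (V : Submodule ℂ E)
    (hV : IsClosed (V : Set E)) {u : ι → E} (hu : ∀ i, u i ∈ V)
    (h : ∀ g ∈ V, (∀ i, ⟪u i, g⟫_ℂ = 0) → g = 0) : IsCompleteSystemIn (V : Set E) u := by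
  refine ⟨hu, fun g hg ↦ ?_⟩
  set M : Submodule ℂ E := (Submodule.span ℂ (Set.range u)).topologicalClosure with hM
  have hMV : M ≤ V := by
    refine Submodule.topologicalClosure_minimal _ (Submodule.span_le.2 ?_) hV
    rintro _ ⟨i, rfl⟩
    exact hu i
  haveI : CompleteSpace M := (Submodule.isClosed_topologicalClosure _).completeSpace_coe
  set m : E := M.starProjection g with hm
  have hmM : m ∈ M := Submodule.starProjection_apply_mem _ g
  have hn : g - m ∈ Mᗮ := Submodule.sub_starProjection_mem_orthogonal g
  have hnV : g - m ∈ V := V.sub_mem hg (hMV hmM)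
  have hn0 : g - m = 0 := by
    refine h _ hnV fun i ↦ Submodule.inner_right_of_mem_orthogonal ?_ hn
    exact Submodule.le_topologicalClosure _ (Submodule.subset_span ⟨i, rfl⟩)
  have hgm : g = m := sub_eq_zero.1 hn0
  rw [hgm]
  show m ∈ closure (Submodule.span ℂ (Set.range u) : Set E)
  rw [← Submodule.topologicalClosure_coe]
  exact hmM

/-- **Dual vector of a minimal system**: if `u` is minimal, for each `i` there is a vector orthogonal to
all `u j`, `j ≠ i`, and not orthogonal to `u i` (the component of `u i` orthogonal to the closed span of
the others). [cite: Burnol2004b, §3 (arXiv:math/0203120v7 p. 6, TeX l.551–555)] -/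
theorem exists_dual_vector_of_isMinimalSystem {ι : Type*} {u : ι → E} (h : IsMinimalSystem u) (i : ι) :
    ∃ g : E, (∀ j, j ≠ i → ⟪u j, g⟫_ℂ = 0) ∧ ⟪u i, g⟫_ℂ ≠ 0 := by
  set M : Submodule ℂ E := (Submodule.span ℂ (u '' {j | j ≠ i})).topologicalClosure with hM
  haveI : CompleteSpace M := (Submodule.isClosed_topologicalClosure _).completeSpace_coe
  set g : E := u i - M.starProjection (u i) with hg
  have hgM : g ∈ Mᗮ := Submodule.sub_starProjection_mem_orthogonal (u i)
  have hg0 : g ≠ 0 := by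
    intro h0
    have hui : u i ∈ M := by
      rw [hg, sub_eq_zero] at h0
      rw [h0]
      exact Submodule.starProjection_apply_mem _ _
    apply h i
    show u i ∈ closure (Submodule.span ℂ (u '' {j | j ≠ i}) : Set E)
    rw [← Submodule.topologicalClosure_coe]
    exact hui
  refine ⟨g, fun j hj ↦ ?_, ?_⟩
  · refine Submodule.inner_right_of_mem_orthogonal ?_ hgM
    exact Submodule.le_topologicalClosure _ (Submodule.subset_span ⟨j, hj, rfl⟩)
  · have h1 : ⟪u i, g⟫_ℂ = ⟪g, g⟫_ℂ := by
      have h2 : ⟪M.starProjection (u i), g⟫_ℂ = 0 :=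
        Submodule.inner_right_of_mem_orthogonal (Submodule.starProjection_apply_mem _ _) hgM
      have h3 : u i = g + M.starProjection (u i) := by rw [hg]; abel
      rw [h3, inner_add_left, h2, add_zero]
    rw [h1]
    exact fun h0 ↦ hg0 (inner_self_eq_zero.1 h0)

end Hilbert

/-! ## G. "Evaluators in `K_a` project orthogonally to the evaluators in `K_b` for `b ≥ a`":
monotonicity of completeness (upward in `a`) and of minimality (downward in `a`) -/

section Monotone

open scoped InnerProductSpace
open BurnolEvaluators

/-- **The evaluators at two levels `a ≤ a'` pair identically with the smaller space `K_{a'}`**: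
for `g ∈ K_{a'}`, `⟪Z^a_{w,k}, g⟫ = ⟪Z^{a'}_{w,k}, g⟫` — both are `conj (2·𝒢_{ḡ}^{(k)}(w))` with
`ḡ ∈ K_{a'} ⊆ K_a` (this is the printed "evaluators in `K_a` projecting orthogonally to the evaluators in
`K_b` for `b ≥ a`"). [cite: Burnol2004b, §7 (arXiv:math/0203120v7 p. 17, TeX l.1389–1392)] -/
theorem inner_eq_inner_of_isSonineZ_of_le {a a' : ℝ} (hab : a ≤ a') {w : ℂ} {k : ℕ}
    {Z Z' : Lp ℂ 2 (volume : Measure ℝ)} (hZ : IsSonineZ a w k Z) (hZ' : IsSonineZ a' w k Z')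
    {g : Lp ℂ 2 (volume : Measure ℝ)} (hg : g ∈ sonineK a') : ⟪Z, g⟫_ℂ = ⟪Z', g⟫_ℂ := by
  obtain ⟨v, hv⟩ := exists_conj g
  have hvK' : v ∈ sonineK a' := mem_sonineK_of_conj hg hv
  have hvK : v ∈ sonineK a := sonineK_antitone hab hvK'
  have hgK : g ∈ sonineK a := sonineK_antitone hab hg
  -- `⟪g, Y⟫ = 2 ∫₀^∞ v·Y` for even `Y`
  have key : ∀ Y : Lp ℂ 2 (volume : Measure ℝ), Y ∈ evenL2 →
      ⟪g, Y⟫_ℂ = 2 * ∫ t in Ioi (0 : ℝ), (v : ℝ → ℂ) t * (Y : ℝ → ℂ) t := by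
    intro Y hY
    rw [inner_eq_setIntegral_Ioi hgK.1 hY hv, ← integral_const_mul]
    refine integral_congr_ae ((ae_restrict_of_ae (Lp.coeFn_smul (2 : ℂ) v)).mono fun t ht ↦ ?_)
    simp only [ht, Pi.smul_apply, smul_eq_mul]
    ring
  have h1 : ⟪g, Z⟫_ℂ = ⟪g, Z'⟫_ℂ := by
    rw [key Z hZ.1.1, key Z' hZ'.1.1, hZ.2 v hvK, hZ'.2 v hvK']
  rw [← inner_conj_symm, h1, inner_conj_symm]

/-- **Completeness passes UP in `a`**: if the evaluator system of `𝒵` is complete in `K_a` then it is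
complete in `K_{a'}` for `a ≤ a'` ("the index `a₂(𝒵)` will be such that the evaluators are complete for
`a > a₂(𝒵)` but not complete for `a < a₂(𝒵)`" — the threshold reading). Evaluator existence (Thm. 2.1 +
Riesz) is the hypothesis `hev`. [cite: Burnol2004b, §7 (arXiv:math/0203120v7 p. 17, TeX l.1389–1398)] -/
theorem isCompleteSystemIn_sonineZSystem_of_le
    (hev : ∀ a : ℝ, 0 < a → ∀ (w : ℂ) (k : ℕ), IsSonineZ a w k (sonineZ a w k))
    {Z : ℂ → ℕ} {a a' : ℝ} (ha : 0 < a) (hab : a ≤ a')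
    (h : IsCompleteSystemIn (sonineK a) (sonineZSystem a Z)) :
    IsCompleteSystemIn (sonineK a') (sonineZSystem a' Z) := by
  have ha' : 0 < a' := lt_of_lt_of_le ha hab
  have hu : ∀ p : MultisetIndex Z, sonineZSystem a' Z p ∈ sonineK a' :=
    fun p ↦ (hev a' ha' p.1.1 p.1.2).1
  have hu' : ∀ p : MultisetIndex Z,
      sonineZSystem a' Z p ∈ Literature.NumberTheory.ConnesConsani2021.soninSpace a' a' := by
    intro p
    rw [← SetLike.mem_coe, ← sonineK_eq_soninSpace]
    exact hu p
  rw [sonineK_eq_soninSpace]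
  refine isCompleteSystemIn_of_forall_inner_eq_zero
    (Literature.NumberTheory.ConnesConsani2021.soninSpace a' a')
    (Literature.NumberTheory.ConnesConsani2021.isClosed_soninSpace a' a') hu' fun g hg h0 ↦ ?_
  have hg' : g ∈ sonineK a' := by
    rw [sonineK_eq_soninSpace, SetLike.mem_coe]
    exact hg
  refine eq_zero_of_isCompleteSystemIn h (sonineK_antitone hab hg') fun p ↦ ?_
  exact (inner_eq_inner_of_isSonineZ_of_le hab (hev a ha p.1.1 p.1.2) (hev a' ha' p.1.1 p.1.2)
    hg').trans (h0 p)

/-- **Minimality passes DOWN in `a`**: if the evaluator system of `𝒵` is minimal in `K_a` then it is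
minimal in `K_{a''}` for `a'' ≤ a` ("the evaluators are a minimal system for `a < a₁(𝒵)` and not a
minimal system for `a > a₁(𝒵)`"): a dual vector at level `a`, projected into `K_a`, is a dual vector at
level `a''`. Evaluator existence is the hypothesis `hev`. [cite: Burnol2004b, §7 (arXiv:math/0203120v7 p. 17, TeX l.1389–1398)] -/
theorem isMinimalSystem_sonineZSystem_of_le
    (hev : ∀ a : ℝ, 0 < a → ∀ (w : ℂ) (k : ℕ), IsSonineZ a w k (sonineZ a w k))
    {Z : ℂ → ℕ} {a'' a : ℝ} (ha'' : 0 < a'') (hab : a'' ≤ a)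
    (h : IsMinimalSystem (sonineZSystem a Z)) :
    IsMinimalSystem (sonineZSystem a'' Z) := by
  have ha : 0 < a := lt_of_lt_of_le ha'' hab
  intro i hi
  -- a dual vector at level `a`
  obtain ⟨g, hg0, hg1⟩ := exists_dual_vector_of_isMinimalSystem h i
  -- project it into `K_a`
  set V := Literature.NumberTheory.ConnesConsani2021.soninSpace a a with hV
  set g' : Lp ℂ 2 (volume : Measure ℝ) := V.starProjection g with hg'
  have hg'K : g' ∈ sonineK a := by
    rw [sonineK_eq_soninSpace, SetLike.mem_coe]
    exact Submodule.starProjection_apply_mem _ g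
  have hinner : ∀ v : Lp ℂ 2 (volume : Measure ℝ), v ∈ sonineK a → ⟪v, g'⟫_ℂ = ⟪v, g⟫_ℂ := by
    intro v hv
    have hvV : v ∈ V := by
      rw [hV, ← SetLike.mem_coe, ← sonineK_eq_soninSpace]
      exact hv
    rw [hg', ← Submodule.inner_starProjection_left_eq_right,
      Submodule.starProjection_eq_self_iff.2 hvV]
  have hmem : ∀ p : MultisetIndex Z, sonineZSystem a Z p ∈ sonineK a :=
    fun p ↦ (hev a ha p.1.1 p.1.2).1
  -- at level `a''` the evaluators pair with `g' ∈ K_a` as at level `a`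
  have htr : ∀ p : MultisetIndex Z, ⟪sonineZSystem a'' Z p, g'⟫_ℂ = ⟪sonineZSystem a Z p, g⟫_ℂ :=
    fun p ↦ (inner_eq_inner_of_isSonineZ_of_le hab (hev a'' ha'' p.1.1 p.1.2) (hev a ha p.1.1 p.1.2)
      hg'K).trans (hinner _ (hmem p))
  refine not_mem_closure_span_of_dual_vector (u := sonineZSystem a'' Z) (g := g')
    (fun j hj ↦ ?_) ?_ hi
  · rw [htr]; exact hg0 j hj
  · rw [htr]; exact hg1

/-- The two monotonicities in threshold form: below a complete level nothing changes upward, above a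
minimal level nothing changes downward; e.g. `a₂(𝒵) < a ⇒` complete in `K_a`, and
`a < a₁(𝒵) ⇒` minimal in `K_a`. [cite: Burnol2004b, §7 (arXiv:math/0203120v7 p. 17, TeX l.1389–1398)] -/
theorem isCompleteSystemIn_of_sonineCompleteIndex_lt
    (hev : ∀ a : ℝ, 0 < a → ∀ (w : ℂ) (k : ℕ), IsSonineZ a w k (sonineZ a w k))
    {Z : ℂ → ℕ} {a : ℝ} (ha : 0 < a) (h : sonineCompleteIndex Z < ENNReal.ofReal a) :
    IsCompleteSystemIn (sonineK a) (sonineZSystem a Z) := by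
  obtain ⟨b, hb, hba, hcomp⟩ := exists_isCompleteSystemIn_of_sonineCompleteIndex_lt h
  exact isCompleteSystemIn_sonineZSystem_of_le hev hb ((ENNReal.ofReal_lt_ofReal_iff ha).1 hba).le hcomp

/-- `a < a₁(𝒵) ⇒` the evaluator system is minimal in `K_a`.
[cite: Burnol2004b, §7 (arXiv:math/0203120v7 p. 17, TeX l.1389–1398)] -/
theorem isMinimalSystem_of_lt_sonineMinimalIndex
    (hev : ∀ a : ℝ, 0 < a → ∀ (w : ℂ) (k : ℕ), IsSonineZ a w k (sonineZ a w k))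
    {Z : ℂ → ℕ} {a : ℝ} (ha : 0 < a) (h : ENNReal.ofReal a < sonineMinimalIndex Z) :
    IsMinimalSystem (sonineZSystem a Z) := by
  obtain ⟨a', ha', haa', hmin⟩ := exists_isMinimalSystem_of_lt_sonineMinimalIndex h
  exact isMinimalSystem_sonineZSystem_of_le hev ha ((ENNReal.ofReal_lt_ofReal_iff ha').1 haa').le hmin

end Monotone

end BurnolSonineIndex


/-! ## Part III: linear independence of the evaluators of `K_a` (Burnol 2001 Thm. 2.3 transported along
`H_Λ = I K_{1/Λ}`), the finite-multiset case of Thm. 7.1, and the hypothesis-free forms (evaluator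
existence is now the tree theorem `SonineMultiset.isSonineZ_sonineZ`) -/

namespace BurnolSonineIndex

open scoped FourierTransform
open Literature.Analysis.DeBrangesSpaces.Burnol2001
  (memHLambda IsCompletedMellin IsEvaluatorZ Burnol2001CRAS_thm2_3_holds isCompletedMellin_toLp_invT)

/-! ## H. Finitely many evaluators of `K_a` are linearly independent (transport of Burnol 2001,
Thm. 2.3 along `H_Λ = I K_{1/Λ}`), hence a finite multiset's evaluators are always minimal -/

section Inversion

/-! ### H.1 Private plumbing: the inversion `I k (t) = k(t⁻¹)/|t|` (copies of the plumbing of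
`BurnolHLambdaDensityProofs.lean` / `BurnolEvaluatorTransport.lean`, kept private there) -/

/-- `t ↦ t⁻¹` is quasi-measure-preserving for Lebesgue measure. [folklore] -/
private theorem quasiMeasurePreserving_inv_real :
    Measure.QuasiMeasurePreserving (fun t : ℝ ↦ t⁻¹) volume volume := by
  refine ⟨measurable_inv, Measure.AbsolutelyContinuous.mk fun N hN hN0 ↦ ?_⟩
  rw [Measure.map_apply measurable_inv hN]
  have hsub : (fun t : ℝ ↦ t⁻¹) ⁻¹' N ⊆ (fun t : ℝ ↦ t⁻¹) '' (N \ {0}) ∪ {0} := by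
    intro t ht
    by_cases ht0 : t = 0
    · exact Or.inr ht0
    · exact Or.inl ⟨t⁻¹, ⟨ht, inv_ne_zero ht0⟩, inv_inv t⟩
  have hdiff : DifferentiableOn ℝ (fun t : ℝ ↦ t⁻¹) (N \ {0}) :=
    fun t ht ↦ (hasDerivAt_inv ht.2).differentiableAt.differentiableWithinAt
  have h1 : volume ((fun t : ℝ ↦ t⁻¹) '' (N \ {0})) = 0 :=
    addHaar_image_eq_zero_of_differentiableOn_of_addHaar_eq_zero volume hdiff
      (measure_mono_null (fun x hx ↦ hx.1) hN0)
  exact measure_mono_null hsub (measure_union_null h1 (measure_singleton 0))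

/-- Almost every real number is non-zero. [folklore] -/
private theorem ae_ne_zero_real : ∀ᵐ t : ℝ, t ≠ 0 := by
  have : ({0}ᶜ : Set ℝ) ∈ ae (volume : Measure ℝ) := compl_mem_ae_iff.2 (measure_singleton 0)
  filter_upwards [this] with t ht
  exact ht

/-- `ℝ ∖ {0}` has full measure. [folklore] -/
private theorem compl_zero_ae_eq_univ : (({0}ᶜ : Set ℝ)) =ᵐ[volume] (univ : Set ℝ) :=
  ae_eq_univ.2 (by rw [compl_compl]; exact measure_singleton (0 : ℝ))

/-- The image of `ℝ ∖ {0}` under `t ↦ t⁻¹` is `ℝ ∖ {0}`. [folklore] -/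
private theorem image_inv_compl_zero :
    (fun t : ℝ ↦ t⁻¹) '' ({0}ᶜ : Set ℝ) = ({0}ᶜ : Set ℝ) := by
  ext x
  simp only [mem_image, mem_compl_iff, mem_singleton_iff]
  constructor
  · rintro ⟨t, ht, rfl⟩
    exact inv_ne_zero ht
  · intro hx
    exact ⟨x⁻¹, inv_ne_zero hx, inv_inv x⟩

/-- `‖k(t⁻¹)/|t|‖² = |−(t²)⁻¹| · ‖k(t⁻¹)‖²`. [folklore] -/
private theorem norm_sq_invT_eq (k : ℝ → ℂ) (t : ℝ) :
    ‖k t⁻¹ / ((|t| : ℝ) : ℂ)‖ ^ 2 = |(-(t ^ 2)⁻¹ : ℝ)| • ‖k t⁻¹‖ ^ 2 := by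
  rw [norm_div, Complex.norm_real, Real.norm_eq_abs, abs_abs, div_pow, abs_neg, abs_inv, abs_pow,
    sq_abs, smul_eq_mul]
  ring

/-- **`I k = k(1/t)/|t|` is square integrable** (change of variables `u = 1/t`).
[cite: Burnol2001CRAS, §1 (TeX l.302: "`I` est unitaire")] -/
private theorem memLp_invT (k : Lp ℂ 2 (volume : Measure ℝ)) :
    MemLp (fun t : ℝ ↦ (k : ℝ → ℂ) t⁻¹ / ((|t| : ℝ) : ℂ)) 2 volume := by
  have hmeas : AEStronglyMeasurable (fun t : ℝ ↦ (k : ℝ → ℂ) t⁻¹ / ((|t| : ℝ) : ℂ)) volume := by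
    have h1 : AEStronglyMeasurable (fun t : ℝ ↦ (k : ℝ → ℂ) t⁻¹) volume :=
      (Lp.aestronglyMeasurable k).comp_quasiMeasurePreserving quasiMeasurePreserving_inv_real
    have h2 : AEStronglyMeasurable (fun t : ℝ ↦ (((|t| : ℝ) : ℂ))⁻¹) volume :=
      (Complex.continuous_ofReal.measurable.comp measurable_abs).inv.aestronglyMeasurable
    exact (h1.mul h2).congr (Eventually.of_forall fun t ↦ (div_eq_mul_inv _ _).symm)
  rw [memLp_two_iff_integrable_sq_norm hmeas]
  have hG : Integrable (fun x : ℝ ↦ ‖(k : ℝ → ℂ) x‖ ^ 2) volume := (memLp_two_iff_integrable_sq_norm (Lp.memLp k).1).1 (Lp.memLp k)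
  have hderiv : ∀ t ∈ ({0}ᶜ : Set ℝ), HasDerivWithinAt (fun t : ℝ ↦ t⁻¹) (-(t ^ 2)⁻¹) ({0}ᶜ : Set ℝ) t :=
    fun t ht ↦ (hasDerivAt_inv ht).hasDerivWithinAt
  have hinj : InjOn (fun t : ℝ ↦ t⁻¹) ({0}ᶜ : Set ℝ) := inv_injective.injOn
  have hOn : IntegrableOn (fun t : ℝ ↦ |(-(t ^ 2)⁻¹ : ℝ)| • ‖(k : ℝ → ℂ) t⁻¹‖ ^ 2) ({0}ᶜ : Set ℝ) := by
    rw [← integrableOn_image_iff_integrableOn_abs_deriv_smul (measurableSet_singleton 0).compl hderiv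
      hinj (fun x : ℝ ↦ ‖(k : ℝ → ℂ) x‖ ^ 2), image_inv_compl_zero]
    exact hG.integrableOn
  have hOn' : IntegrableOn (fun t : ℝ ↦ ‖(k : ℝ → ℂ) t⁻¹ / ((|t| : ℝ) : ℂ)‖ ^ 2) ({0}ᶜ : Set ℝ) :=
    hOn.congr_fun (fun t _ ↦ (norm_sq_invT_eq _ t).symm) (measurableSet_singleton 0).compl
  have huniv : IntegrableOn (fun t : ℝ ↦ ‖(k : ℝ → ℂ) t⁻¹ / ((|t| : ℝ) : ℂ)‖ ^ 2) (univ : Set ℝ) :=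
    hOn'.congr_set_ae compl_zero_ae_eq_univ.symm
  exact integrableOn_univ.1 huniv

/-- `I` preserves evenness. [folklore] -/
private theorem toLp_invT_mem_evenL2 {k : Lp ℂ 2 (volume : Measure ℝ)} (hk : k ∈ evenL2) :
    (memLp_invT k).toLp (fun t : ℝ ↦ (k : ℝ → ℂ) t⁻¹ / ((|t| : ℝ) : ℂ)) ∈ evenL2 := by
  have hk' : ∀ᵐ u : ℝ, (k : ℝ → ℂ) (-u) = (k : ℝ → ℂ) u := hk
  have hneg : Measure.QuasiMeasurePreserving (fun x : ℝ ↦ -x) volume volume :=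
    (Measure.measurePreserving_neg (volume : Measure ℝ)).quasiMeasurePreserving
  have hae := (memLp_invT k).coeFn_toLp
  have hae' := hneg.ae hae
  have hk'' := quasiMeasurePreserving_inv_real.ae hk'
  simp only [evenL2, Set.mem_setOf_eq]
  filter_upwards [hae, hae', hk''] with t h1 h2 h3
  rw [h2, h1, inv_neg, h3, abs_neg]

/-- `I` is an involution (a.e. form): with `f = Ik`, `k(t) = f(t⁻¹)/|t|` for a.e. `t`.
[cite: Burnol2001CRAS, §1–2 (TeX l.302, 410–418)] -/
private theorem ae_invT_invT (k : Lp ℂ 2 (volume : Measure ℝ)) :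
    ∀ᵐ t : ℝ, (k : ℝ → ℂ) t =
      ((memLp_invT k).toLp (fun t : ℝ ↦ (k : ℝ → ℂ) t⁻¹ / ((|t| : ℝ) : ℂ)) : ℝ → ℂ) t⁻¹ /
        ((|t| : ℝ) : ℂ) := by
  have hae := (memLp_invT k).coeFn_toLp
  have hae' := quasiMeasurePreserving_inv_real.ae hae
  filter_upwards [hae', ae_ne_zero_real] with t ht ht0
  rw [ht, inv_inv, abs_inv]
  have h : ((|t| : ℝ) : ℂ) ≠ 0 := by exact_mod_cast (abs_pos.2 ht0).ne'
  push_cast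
  field_simp

/-- **`I` maps `K_λ` into `H_{1/λ}`**: for `k ∈ K_λ` the class `Ik` satisfies `memHLambda λ⁻¹`.
[cite: Burnol2001CRAS, §2 (TeX l.410–418)] -/
private theorem memHLambda_toLp_invT {lam : ℝ} (hlam : 0 < lam) {k : Lp ℂ 2 (volume : Measure ℝ)}
    (hk : k ∈ sonineK lam) :
    memHLambda lam⁻¹ ((memLp_invT k).toLp (fun t : ℝ ↦ (k : ℝ → ℂ) t⁻¹ / ((|t| : ℝ) : ℂ))) := by
  obtain ⟨hke, hk0, hk1⟩ := hk
  have hke' : ∀ᵐ u : ℝ, (k : ℝ → ℂ) (-u) = (k : ℝ → ℂ) u := hke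
  have hneg : Measure.QuasiMeasurePreserving (fun x : ℝ ↦ -x) volume volume :=
    (Measure.measurePreserving_neg (volume : Measure ℝ)).quasiMeasurePreserving
  have hk0' : ∀ᵐ u : ℝ, |u| < lam → u ≠ 0 → (k : ℝ → ℂ) u = 0 := by
    have h := hneg.ae hk0
    filter_upwards [hk0, h, hke'] with u h1 h2 h3 hu hu0
    rcases lt_or_gt_of_ne hu0 with hneg' | hpos
    · rw [← h3]
      exact h2 ⟨by linarith, by rw [abs_of_neg hneg'] at hu; linarith⟩
    · exact h1 ⟨hpos, by rwa [abs_of_pos hpos] at hu⟩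
  have hae := (memLp_invT k).coeFn_toLp
  refine ⟨toLp_invT_mem_evenL2 hke, ?_, ⟨k, ae_invT_invT k, ?_⟩⟩
  · have h := quasiMeasurePreserving_inv_real.ae hk0'
    filter_upwards [hae, h] with t h1 h2 ht
    have ht0 : t ≠ 0 := by
      rintro rfl
      rw [abs_zero] at ht
      exact absurd ht (not_lt.2 (inv_pos.2 hlam).le)
    have hlt : |t⁻¹| < lam := by
      rw [abs_inv]
      calc |t|⁻¹ < lam⁻¹⁻¹ := by
            apply inv_strictAnti₀ (inv_pos.2 hlam) ht
        _ = lam := inv_inv lam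
    rw [h1, h2 hlt (inv_ne_zero ht0), zero_div]
  · rw [inv_inv]
    have hFe : ∀ᵐ u : ℝ, ((𝓕 k : Lp ℂ 2 (volume : Measure ℝ)) : ℝ → ℂ) (-u) =
        ((𝓕 k : Lp ℂ 2 (volume : Measure ℝ)) : ℝ → ℂ) u := fourier_mem_evenL2 hke
    have h := hneg.ae hk1
    filter_upwards [hk1, h, hFe, ae_ne_zero_real] with u h1 h2 h3 hu0 hu
    rcases lt_or_gt_of_ne hu0 with hneg' | hpos
    · rw [← h3]
      exact h2 ⟨by linarith, by rw [abs_of_neg hneg'] at hu; linarith⟩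
    · exact h1 ⟨hpos, by rwa [abs_of_pos hpos] at hu⟩

/-! ### H.2 From `H_Λ` back to `K_{1/Λ}`, the pairing under `I`, and uniqueness of `M(f)` -/

/-- **`H_Λ = I K_{1/Λ}`, the other inclusion**: an `f ∈ H_Λ` IS `Ig` for a `g ∈ K_{1/Λ}` (namely the
`g` of the `𝒢`-clause of `memHLambda`). [cite: Burnol2001CRAS, §2 (TeX l.410–418: "On a `H_Λ = I K_{λ,λ}` avec `λ = 1/Λ`")] -/
theorem exists_mem_sonineK_of_memHLambda {Λ : ℝ} (hΛ : 0 < Λ) {f : Lp ℂ 2 (volume : Measure ℝ)}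
    (hf : memHLambda Λ f) :
    ∃ g : Lp ℂ 2 (volume : Measure ℝ), g ∈ sonineK Λ⁻¹ ∧
      ∃ hg : MemLp (fun t : ℝ ↦ (g : ℝ → ℂ) t⁻¹ / ((|t| : ℝ) : ℂ)) 2 volume,
        f = hg.toLp (fun t : ℝ ↦ (g : ℝ → ℂ) t⁻¹ / ((|t| : ℝ) : ℂ)) := by
  obtain ⟨heven, hzero, g, hg, hFg⟩ := hf
  have heven' : ∀ᵐ u : ℝ, (f : ℝ → ℂ) (-u) = (f : ℝ → ℂ) u := heven
  have hneg : Measure.QuasiMeasurePreserving (fun x : ℝ ↦ -x) volume volume :=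
    (Measure.measurePreserving_neg (volume : Measure ℝ)).quasiMeasurePreserving
  refine ⟨g, ⟨?_, ?_, ?_⟩, memLp_invT g, ?_⟩
  · -- `g` is even
    have h1 := hneg.ae hg
    have h2 := quasiMeasurePreserving_inv_real.ae heven'
    simp only [evenL2, Set.mem_setOf_eq]
    filter_upwards [hg, h1, h2] with t ht ht1 ht2
    rw [ht1, ht, inv_neg, abs_neg, ht2]
  · -- `g = 0` a.e. on `(0, 1/Λ)`
    have h1 := quasiMeasurePreserving_inv_real.ae hzero
    filter_upwards [hg, h1] with t ht ht1 htI
    have hlt : Λ < |t⁻¹| := by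
      rw [abs_inv, abs_of_pos htI.1]
      rw [lt_inv_comm₀ hΛ htI.1]
      exact htI.2
    rw [ht, ht1 hlt, zero_div]
  · -- `𝓕 g = 0` a.e. on `(0, 1/Λ)`
    filter_upwards [hFg] with t ht htI
    exact ht (by rw [abs_of_pos htI.1]; exact htI.2)
  · -- `f = I g`
    apply Lp.ext
    have h1 := quasiMeasurePreserving_inv_real.ae hg
    filter_upwards [(memLp_invT g).coeFn_toLp, h1, ae_ne_zero_real] with t ht ht1 ht0
    rw [ht, ht1, inv_inv, abs_inv]
    have h : ((|t| : ℝ) : ℂ) ≠ 0 := by exact_mod_cast (abs_pos.2 ht0).ne'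
    push_cast
    field_simp

/-- **`I` preserves the euclidean pairing on `(0,∞)`**: `∫₀^∞ (Ik)(Iz) = ∫₀^∞ k z` (substitution
`u = 1/t`, `(Ik)(t)(Iz)(t) = k(u)z(u)·u²` and `dt = u⁻² du`). [cite: Burnol2001CRAS, §1 (TeX l.297–302)] -/
theorem setIntegral_invT_mul_invT (k z : Lp ℂ 2 (volume : Measure ℝ))
    (hk : MemLp (fun t : ℝ ↦ (k : ℝ → ℂ) t⁻¹ / ((|t| : ℝ) : ℂ)) 2 volume)
    (hz : MemLp (fun t : ℝ ↦ (z : ℝ → ℂ) t⁻¹ / ((|t| : ℝ) : ℂ)) 2 volume) :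
    ∫ t in Ioi (0 : ℝ), (hk.toLp _ : ℝ → ℂ) t * (hz.toLp _ : ℝ → ℂ) t =
      ∫ t in Ioi (0 : ℝ), (k : ℝ → ℂ) t * (z : ℝ → ℂ) t := by
  have h1 : ∫ t in Ioi (0 : ℝ), (hk.toLp _ : ℝ → ℂ) t * (hz.toLp _ : ℝ → ℂ) t =
      ∫ t in Ioi (0 : ℝ), (|(-1 : ℝ)| * t ^ ((-1 : ℝ) - 1)) •
        ((fun u : ℝ ↦ (k : ℝ → ℂ) u * (z : ℝ → ℂ) u) (t ^ (-1 : ℝ))) := by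
    refine setIntegral_congr_ae measurableSet_Ioi ?_
    filter_upwards [hk.coeFn_toLp, hz.coeFn_toLp] with t ht1 ht2 ht
    rw [ht1, ht2, Real.rpow_neg_one, abs_of_pos ht, abs_neg, abs_one, one_mul,
      show ((-1 : ℝ) - 1) = -2 by norm_num, Real.rpow_neg ht.le, Complex.real_smul]
    have ht0 : (t : ℂ) ≠ 0 := by exact_mod_cast ht.ne'
    have h2 : ((t ^ (2 : ℝ))⁻¹ : ℝ) = (t ^ 2)⁻¹ := by norm_num
    rw [h2]
    push_cast
    field_simp
  rw [h1]
  exact integral_comp_rpow_Ioi (fun u : ℝ ↦ (k : ℝ → ℂ) u * (z : ℝ → ℂ) u) (by norm_num)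

/-- **Uniqueness of the completed Mellin transform `M(f)` of Prop. 2.2** (two entire functions agreeing
with `Γ_ℝ(s)∫₀^∞ f t^{s−1}` on `Re s > 1/2` coincide — identity theorem).
[cite: Burnol2001CRAS, §2 (TeX l.437–441)] -/
theorem IsCompletedMellin.unique {f : ℝ → ℂ} {M₁ M₂ : ℂ → ℂ} (h₁ : IsCompletedMellin f M₁)
    (h₂ : IsCompletedMellin f M₂) : M₁ = M₂ := by
  have ha₁ : AnalyticOnNhd ℂ M₁ univ := h₁.1.differentiableOn.analyticOnNhd isOpen_univ
  have ha₂ : AnalyticOnNhd ℂ M₂ univ := h₂.1.differentiableOn.analyticOnNhd isOpen_univ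
  have hopen : IsOpen {s : ℂ | 1 / 2 < s.re} := isOpen_lt continuous_const Complex.continuous_re
  have hmem : (1 : ℂ) ∈ {s : ℂ | 1 / 2 < s.re} := by simp only [mem_setOf_eq, one_re]; norm_num
  have hev : M₁ =ᶠ[𝓝 (1 : ℂ)] M₂ := by
    filter_upwards [hopen.mem_nhds hmem] with s hs
    rw [h₁.2 s hs, h₂.2 s hs]
  exact funext fun s ↦
    ha₁.eqOn_of_preconnected_of_eventuallyEq ha₂ isPreconnected_univ (mem_univ _) hev (mem_univ s)

/-! ### H.3 The evaluators of `K_λ` transport to the evaluators of `H_{1/λ}`; linear independence -/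

/-- **`I` carries the evaluator `Z^λ_{w,k}` of `K_λ` (for `𝒢` and `∫₀^∞`) to the evaluator
`Z^{1/λ}_{w,k}` of `H_{1/λ}`** ("Under `I` this is Burnol 2004's `Z^{1/Λ}_{w,k} ∈ K_{1/Λ}`", the
docstring of `IsEvaluatorZ`): `M(Ig) = 𝒢_g` and `∫₀^∞ (Ig)(IZ) = ∫₀^∞ gZ`.
[cite: Burnol2001CRAS, §2 and Prop. 2.2 (TeX l.410–418, 463–466); Burnol2004b, Thm. 2.1 (arXiv:math/0203120v7 p. 5)] -/
theorem isEvaluatorZ_toLp_invT {lam : ℝ} (hlam : 0 < lam) {w : ℂ} {k : ℕ}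
    {Z : Lp ℂ 2 (volume : Measure ℝ)} (hZ : IsSonineZ lam w k Z)
    (hZm : MemLp (fun t : ℝ ↦ (Z : ℝ → ℂ) t⁻¹ / ((|t| : ℝ) : ℂ)) 2 volume) :
    IsEvaluatorZ lam⁻¹ w k (hZm.toLp _) := by
  refine ⟨memHLambda_toLp_invT hlam hZ.1, fun f hf M hM ↦ ?_⟩
  obtain ⟨g, hg, hgm, rfl⟩ := exists_mem_sonineK_of_memHLambda (inv_pos.2 hlam) hf
  rw [inv_inv] at hg
  have hM' : IsCompletedMellin (hgm.toLp _) (completedMellinEntire (g : ℝ → ℂ)) :=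
    isCompletedMellin_toLp_invT hlam hg
  rw [IsCompletedMellin.unique hM hM', setIntegral_invT_mul_invT g Z hgm hZm]
  exact hZ.2 g hg

/-- **Finitely many evaluators of `K_λ` are linearly independent** — the `K_λ` form, transported along
`H_Λ = I K_{1/Λ}`, of Burnol 2001 Thm. 2.3 (tree theorem `Burnol2001CRAS_thm2_3_holds`); Burnol 2004b
records it at TeX l.1461–1464 ("our statement from [Burnol2002CRAS] that finitely many evaluators are
always linearly independent in `K_a`"): any assignment `(w,k) ↦ Z^λ_{w,k}` of evaluators of `K_λ` is a
linearly independent family. [cite: Burnol2001CRAS, Théorème 2.3 (TeX l.475–477); Burnol2004b, §7 (arXiv:math/0203120v7 p. 18, TeX l.1461–1464)] -/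
theorem linearIndependent_of_isSonineZ {lam : ℝ} (hlam : 0 < lam)
    {Z : ℂ × ℕ → Lp ℂ 2 (volume : Measure ℝ)} (hZ : ∀ p, IsSonineZ lam p.1 p.2 (Z p)) :
    LinearIndependent ℂ Z := by
  classical
  set ZH : ℂ × ℕ → Lp ℂ 2 (volume : Measure ℝ) := fun p ↦
    (memLp_invT (Z p)).toLp (fun t : ℝ ↦ ((Z p : Lp ℂ 2 (volume : Measure ℝ)) : ℝ → ℂ) t⁻¹ /
      ((|t| : ℝ) : ℂ)) with hZH
  have hZH' : ∀ p, IsEvaluatorZ lam⁻¹ p.1 p.2 (ZH p) :=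
    fun p ↦ isEvaluatorZ_toLp_invT hlam (hZ p) (memLp_invT (Z p))
  have hind : LinearIndependent ℂ ZH := Burnol2001CRAS_thm2_3_holds lam⁻¹ (inv_pos.2 hlam) ZH hZH'
  rw [linearIndependent_iff'] at hind ⊢
  intro S c hsum
  refine hind S c (Lp.ext ?_)
  -- `Σ c_p (I Z_p) = I (Σ c_p Z_p) = 0` almost everywhere
  have h0 : ((∑ p ∈ S, c p • Z p : Lp ℂ 2 (volume : Measure ℝ)) : ℝ → ℂ) =ᵐ[volume] 0 := by
    rw [hsum]; exact Lp.coeFn_zero ℂ 2 volume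
  have h1 := Lp.coeFn_fun_finsetSum S (fun p ↦ c p • Z p)
  have h2 : ∀ᵐ t : ℝ, ∀ p ∈ S, ((c p • Z p : Lp ℂ 2 (volume : Measure ℝ)) : ℝ → ℂ) t =
      c p * ((Z p : Lp ℂ 2 (volume : Measure ℝ)) : ℝ → ℂ) t := by
    rw [Filter.eventually_all_finset]
    intro p _
    filter_upwards [Lp.coeFn_smul (c p) (Z p)] with t ht
    rw [ht, Pi.smul_apply, smul_eq_mul]
  have hsum0 : ∀ᵐ t : ℝ, ∑ p ∈ S, c p * ((Z p : Lp ℂ 2 (volume : Measure ℝ)) : ℝ → ℂ) t = 0 := by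
    filter_upwards [h0, h1, h2] with t ht0 ht1 ht2
    rw [← Finset.sum_congr rfl ht2, ← ht1, ht0, Pi.zero_apply]
  have hsum0' := quasiMeasurePreserving_inv_real.ae hsum0
  have h3 := Lp.coeFn_fun_finsetSum S (fun p ↦ c p • ZH p)
  have h4 : ∀ᵐ t : ℝ, ∀ p ∈ S, ((c p • ZH p : Lp ℂ 2 (volume : Measure ℝ)) : ℝ → ℂ) t =
      c p * (((Z p : Lp ℂ 2 (volume : Measure ℝ)) : ℝ → ℂ) t⁻¹ / ((|t| : ℝ) : ℂ)) := by
    rw [Filter.eventually_all_finset]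
    intro p _
    filter_upwards [Lp.coeFn_smul (c p) (ZH p), (memLp_invT (Z p)).coeFn_toLp] with t ht ht'
    rw [ht, Pi.smul_apply, smul_eq_mul, ht']
  filter_upwards [h3, h4, hsum0', Lp.coeFn_zero ℂ 2 (volume : Measure ℝ)] with t ht3 ht4 ht5 ht6
  rw [ht3, Finset.sum_congr rfl ht4, ht6, Pi.zero_apply]
  have : ∑ p ∈ S, c p * (((Z p : Lp ℂ 2 (volume : Measure ℝ)) : ℝ → ℂ) t⁻¹ / ((|t| : ℝ) : ℂ)) =
      (∑ p ∈ S, c p * ((Z p : Lp ℂ 2 (volume : Measure ℝ)) : ℝ → ℂ) t⁻¹) / ((|t| : ℝ) : ℂ) := by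
    rw [Finset.sum_div]
    exact Finset.sum_congr rfl fun p _ ↦ by ring
  rw [this, ht5, zero_div]

/-- **The evaluators `Z^a_{w,k}` of `K_a`, over ALL `(w,k) ∈ ℂ × ℕ`, are linearly independent.**
[cite: Burnol2004b, §7 (arXiv:math/0203120v7 p. 18, TeX l.1461–1464); Burnol2001CRAS, Théorème 2.3 (TeX l.475–477)] -/
theorem linearIndependent_sonineZ {a : ℝ} (ha : 0 < a) :
    LinearIndependent ℂ (fun p : ℂ × ℕ ↦ sonineZ a p.1 p.2) :=
  linearIndependent_of_isSonineZ ha fun p ↦ SonineMultiset.isSonineZ_sonineZ ha p.1 p.2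

/-- The evaluator system of any multiset is linearly independent in every `K_a`.
[cite: Burnol2004b, §7 (arXiv:math/0203120v7 pp. 17–18, TeX l.1382–1389, 1461–1464)] -/
theorem linearIndependent_sonineZSystem {a : ℝ} (ha : 0 < a) (Z : ℂ → ℕ) :
    LinearIndependent ℂ (sonineZSystem a Z) :=
  (linearIndependent_sonineZ ha).comp (fun p : MultisetIndex Z ↦ p.1) Subtype.val_injective

end Inversion

/-! ### H.4 Finite multisets: "always minimal … so `a₁ = +∞`" -/

section FiniteMultiset

/-- A linearly independent family with finitely many vectors is a minimal system (a finite-dimensional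
span is closed). [cite: Burnol2004b, §3 (arXiv:math/0203120v7 p. 6, TeX l.551–555)] -/
theorem isMinimalSystem_of_linearIndependent_of_finite_range {ι : Type*}
    {u : ι → Lp ℂ 2 (volume : Measure ℝ)} (hu : LinearIndependent ℂ u) (hfin : (Set.range u).Finite) :
    IsMinimalSystem u := by
  intro i hi
  have hfin' : (u '' {j | j ≠ i}).Finite := hfin.subset (Set.image_subset_range _ _)
  haveI : FiniteDimensional ℂ (Submodule.span ℂ (u '' {j | j ≠ i})) :=
    FiniteDimensional.span_of_finite ℂ hfin'
  have hcl : IsClosed (Submodule.span ℂ (u '' {j | j ≠ i}) : Set (Lp ℂ 2 (volume : Measure ℝ))) :=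
    Submodule.closed_of_finiteDimensional _
  rw [hcl.closure_eq] at hi
  exact hu.notMem_span_image (s := {j | j ≠ i}) (fun h ↦ h rfl) hi

/-- "As another example we take the multiset to have finite cardinality: then the evaluators are always
minimal": a finite multiset's evaluator system is minimal in every `K_a`.
[cite: Burnol2004b, §7 (arXiv:math/0203120v7 p. 17, TeX l.1402–1404)] -/
theorem isMinimalSystem_sonineZSystem_of_finite {Z : ℂ → ℕ} (hZ : (Function.support Z).Finite)
    {a : ℝ} (ha : 0 < a) : IsMinimalSystem (sonineZSystem a Z) :=
  isMinimalSystem_of_linearIndependent_of_finite_range (linearIndependent_sonineZSystem ha Z)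
    (finite_range_sonineZSystem_of_finite hZ a)

/-- "… so `a₁ = +∞`": for a finite multiset the minimality index is `+∞`.
[cite: Burnol2004b, §7 (arXiv:math/0203120v7 p. 17, TeX l.1402–1404)] -/
theorem sonineMinimalIndex_eq_top_of_finite {Z : ℂ → ℕ} (hZ : (Function.support Z).Finite) :
    sonineMinimalIndex Z = ⊤ := by
  by_contra htop
  have hlt : sonineMinimalIndex Z < ⊤ := lt_top_iff_ne_top.2 htop
  set c : ℝ := (sonineMinimalIndex Z).toReal with hc
  have hc0 : 0 ≤ c := ENNReal.toReal_nonneg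
  have hle : ENNReal.ofReal (c + 1) ≤ sonineMinimalIndex Z :=
    ofReal_le_sonineMinimalIndex (by linarith) (isMinimalSystem_sonineZSystem_of_finite hZ (by linarith))
  rw [← ENNReal.ofReal_toReal htop] at hle
  have := (ENNReal.ofReal_le_ofReal_iff hc0).1 hle
  linarith

/-- **Theorem 7.1 for finite multisets, unconditionally**: "`a₁ = +∞`, and `a₂ = +∞`" (both indices
are `+∞`; the printed example TeX l.1402–1404). [cite: Burnol2004b, Thm. 7.1 and §7 (arXiv:math/0203120v7 p. 17, TeX l.1402–1411)] -/
theorem sonineMinimalIndex_eq_sonineCompleteIndex_of_finite {Z : ℂ → ℕ}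
    (hZ : (Function.support Z).Finite) : sonineMinimalIndex Z = sonineCompleteIndex Z := by
  rw [sonineMinimalIndex_eq_top_of_finite hZ, sonineCompleteIndex_eq_top_of_finite hZ]

end FiniteMultiset

end BurnolSonineIndex

/-! ## I. Hypothesis-free forms (evaluator existence = `SonineMultiset.isSonineZ_sonineZ`) -/

/-- **Theorem 7.3 from Lemmas 7.4 and 7.6 alone** (the evaluator-existence hypothesis of
`Burnol2004b_thm7_3_of` discharged by the tree theorem `SonineMultiset.isSonineZ_sonineZ`, Thm. 2.1 +
Riesz). [cite: Burnol2004b, Thm. 7.3 (arXiv:math/0203120v7 p. 18, TeX l.1424–1428, 1513–1522)] -/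
theorem Burnol2004b_thm7_3_of_lemmas (h74 : Burnol2004b_lemma7_4) (h76 : Burnol2004b_lemma7_6) :
    Burnol2004b_thm7_3 :=
  Burnol2004b_thm7_3_of (fun _ ha w k ↦ SonineMultiset.isSonineZ_sonineZ ha w k) h74 h76

namespace BurnolSonineIndex

/-- Completeness passes UP in `a` (hypothesis-free form of `isCompleteSystemIn_sonineZSystem_of_le`).
[cite: Burnol2004b, §7 (arXiv:math/0203120v7 p. 17, TeX l.1389–1398)] -/
theorem isCompleteSystemIn_sonineZSystem_mono {Z : ℂ → ℕ} {a a' : ℝ} (ha : 0 < a) (hab : a ≤ a')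
    (h : IsCompleteSystemIn (sonineK a) (sonineZSystem a Z)) :
    IsCompleteSystemIn (sonineK a') (sonineZSystem a' Z) :=
  isCompleteSystemIn_sonineZSystem_of_le (fun _ hb w k ↦ SonineMultiset.isSonineZ_sonineZ hb w k) ha hab h

/-- Minimality passes DOWN in `a` (hypothesis-free form of `isMinimalSystem_sonineZSystem_of_le`).
[cite: Burnol2004b, §7 (arXiv:math/0203120v7 p. 17, TeX l.1389–1398)] -/
theorem isMinimalSystem_sonineZSystem_anti {Z : ℂ → ℕ} {a'' a : ℝ} (ha'' : 0 < a'') (hab : a'' ≤ a)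
    (h : IsMinimalSystem (sonineZSystem a Z)) : IsMinimalSystem (sonineZSystem a'' Z) :=
  isMinimalSystem_sonineZSystem_of_le (fun _ hb w k ↦ SonineMultiset.isSonineZ_sonineZ hb w k) ha'' hab h

/-- `a₂(𝒵) < a ⇒` the evaluator system is complete in `K_a` (hypothesis-free).
[cite: Burnol2004b, §7 (arXiv:math/0203120v7 p. 17, TeX l.1389–1398)] -/
theorem isCompleteSystemIn_of_sonineCompleteIndex_lt' {Z : ℂ → ℕ} {a : ℝ} (ha : 0 < a)
    (h : sonineCompleteIndex Z < ENNReal.ofReal a) :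
    IsCompleteSystemIn (sonineK a) (sonineZSystem a Z) :=
  isCompleteSystemIn_of_sonineCompleteIndex_lt (fun _ hb w k ↦ SonineMultiset.isSonineZ_sonineZ hb w k) ha h

/-- `a < a₁(𝒵) ⇒` the evaluator system is minimal in `K_a` (hypothesis-free).
[cite: Burnol2004b, §7 (arXiv:math/0203120v7 p. 17, TeX l.1389–1398)] -/
theorem isMinimalSystem_of_lt_sonineMinimalIndex' {Z : ℂ → ℕ} {a : ℝ} (ha : 0 < a)
    (h : ENNReal.ofReal a < sonineMinimalIndex Z) : IsMinimalSystem (sonineZSystem a Z) :=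
  isMinimalSystem_of_lt_sonineMinimalIndex (fun _ hb w k ↦ SonineMultiset.isSonineZ_sonineZ hb w k) ha h

end BurnolSonineIndex

end Literature.NumberTheory.LFunctions
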